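import Mathlib
import Summits.Ventures.HodgeRepro2.Tier7.Line1.Seesaw

/-!
# Tier7/Line1/Transport — LINE 1 (t7-L1-p1): the `TransportData` of §7 CONSTRUCTED from a displayed transport input

`TwoTorus.lean` §7 takes the transport as an INTERFACE (`TransportData D T`: `tw`, `PA'`, the Prop field `PB_iff`, …).
Here the interface is BUILT from finer displayed data over the seesaw input `h : SeesawInput D` of `Seesaw.lean`, so
that the two printed facts behind `PB_iff` appear as DATA with their own names: (T1) the IDENTIFICATION
`θ^ψ_{V→W'}(Π_σ) ≅ θ^ψ_{V→W}(Π_{tw σ})` of the `B`-lift of a constituent with the `A`-lift of its transport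
`tw σ` (through (H12) `W' ≅ W`, the similitude `g ∈ GU(W)(F)` of factor `u`, Howe duality and multiplicity one on
`U(W)`: Rogawski 1990 Thm 11.5.1 (c) / Labesse–Langlands 1979, lit-2 B39–B41 — an equivalence of ℂ-spaces `ident σ`),
and (T2) the CHANGE OF VARIABLES `P_{T'}(·, χ_B) = P_T(· ∘ Ad(g⁻¹), χ_B')` on `[T'] = g[T]g⁻¹` (`per_ident`: the
`(T', χ_B)`-period functional of the `B`-lift is the `(T, χ_B')`-period functional of the `A`-lift of `tw σ`
transported through `ident σ`). `PB_iff` is then PROVED (`transportData_of_input`): a functional vanishes iff its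
transport through a linear equivalence vanishes. The remaining fields (`tw_tw`: `Ad(g²)` inner + multiplicity one;
`swapOK` / `central` with their NECESSITY clauses: Tunnell 1983 / Saito 1993, the centre) stay displayed exactly as in
`TwoTorus.lean` §7 — nothing new is claimed about them.

WHICH FIELDS OF `TwoTorus.lean`'s `TransportData` THIS FILE DISCHARGES (plan-1 l. 14941): `PB_iff` becomes a THEOREM
(`TransportInput.perB_ne_zero_iff`, from the displayed identification (T1) and change of variables (T2)); `tw`, `tw_tw`,
`swapOK`, `swapOK_of_periods`, `central`, `central_of_periods` stay DISPLAYED (restated on the displayed spectrum of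
`SeesawInput`, same content as §7 — Tunnell 1983 / Saito 1993 for the sign compatibility, the centre for `central`).
Consequences: `two_torus_iff_local` applies to the constructed data, and `TwoTorusLocal` reads, on the displayed
spectrum, «one constituent `σ` of `H^{2,0}(X_∞)` with `swapOK σ`, `central σ`, `perA σ ≠ 0` and `perA' (tw σ) ≠ 0`»
(`two_torus_local_of_input_iff`). No `sorry`; axioms propext / Classical.choice / Quot.sound.
§8(d): uses an L-value-free non-vanishing device: YES — this is step (b) of Line 1's reduction (LEMMAS.md §2 (b)–(c):
the transport of the second torus through the similitude `g`, with the identification of the lifts displayed); NO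
non-vanishing is proved anywhere in the file (plan-1 l. 14941 (2)).
Author: t7-L1-p1 (prover-pub-hodge-repro2-t7-L1-p1-g0-0).
-/

namespace Summit.Ventures.HodgeRepro2.Tier7.Line1

open Summit.Ventures.HodgeRepro2.Tier7

noncomputable section

variable {K : Type} [Field K] [NumberField K] {E' : Type} [Field E'] [NumberField E']
  {V : Type} [AddCommGroup V] [Module E' V] {HX : Type} [Ring HX] [Algebra ℂ HX]
  {G : Type} [Group G] [MulAction G HX] (D : PeriodDatum K E' V HX G)

/-- **THE TRANSPORT INPUT** over a seesaw input `h` (displayed; every field a printed fact about the real objects or a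
necessity clause, locators in the module docstring / proofs/t7/INPUTS.md): `tw σ` = the constituent of `H^{2,0}(X_∞)`
whose `ψ`-lift to `U(W)` is `σ`'s `ψ`-lift conjugated by the similitude `g` (Howe duality + multiplicity one on `U(W)`);
`perA' σ` = the `(T, χ_B')`-period functional on the `A`-lift, `χ_B' = (μ_2 ⊠ μ_3) ∘ Ad(g)`; (T1) `ident σ` = the
identification `θ^ψ_{V→W'}(Π_σ) ≅ θ^ψ_{V→W}(Π_{tw σ})` ((H12) + multiplicity one on `U(W)`); (T2) `per_ident` = the
change of variables `P_{T'}(x, χ_B) = P_T(ident x, χ_B')`; `tw_tw` (`Ad(g²)` is inner, `u² ∈ N(E'^×)`); `swapOK` /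
`central` = the Tunnell–Saito sign compatibility on the swap set and the central condition, each with its NECESSITY
clause (TwoTorus.lean §7 verbatim, restated on the displayed spectrum). -/
structure TransportInput (h : SeesawInput D) where
  /-- the transport `σ ↦ σ ∘ Ad(g⁻¹)` on the displayed spectrum -/
  tw : h.Cons → h.Cons
  /-- `Ad(g²)` is inner + multiplicity one on `U(W)` -/
  tw_tw : ∀ σ, tw (tw σ) = σ
  /-- the `(T, χ_B')`-period functional on the `A`-lift `θ^ψ_{V→W}(Π_σ)` -/
  perA' : ∀ σ, h.SpA σ →ₗ[ℂ] ℂ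
  /-- (T1) the `B`-lift of `σ` IS the `A`-lift of `tw σ` ((H12) `W' ≅ W`, `g`, multiplicity one on `U(W)`) -/
  ident : ∀ σ, h.SpB σ ≃ₗ[ℂ] h.SpA (tw σ)
  /-- (T2) change of variables on `[T'] = g[T]g⁻¹`: the `(T', χ_B)`-period is the `(T, χ_B')`-period of the transport -/
  per_ident : ∀ σ (x : h.SpB σ), h.perB σ x = perA' (tw σ) (ident σ x)
  /-- Tunnell–Saito sign compatibility on the swap set -/
  swapOK : h.Cons → Prop
  /-- it is NECESSARY for both periods to be non-zero (Tunnell 1983 / Saito 1993 at every place) -/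
  swapOK_of_periods : ∀ σ, h.perA σ ≠ 0 → h.perB σ ≠ 0 → swapOK σ
  /-- the central condition `ω_σ · μ_0μ_1 = 1 = ω_σ · μ_2μ_3` on `E'^1` -/
  central : h.Cons → Prop
  /-- it is NECESSARY for both periods to be non-zero (the centre acts by scalars on `σ` and on the functionals) -/
  central_of_periods : ∀ σ, h.perA σ ≠ 0 → h.perB σ ≠ 0 → central σ

/-- a linear functional vanishes iff its transport through a linear equivalence vanishes -/
theorem comp_equiv_eq_zero_iff {M N : Type} [AddCommGroup M] [Module ℂ M] [AddCommGroup N] [Module ℂ N]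
    (f : N →ₗ[ℂ] ℂ) (e : M ≃ₗ[ℂ] N) : (f.comp (e : M →ₗ[ℂ] N)) = 0 ↔ f = 0 := by
  constructor
  · intro h0
    ext y
    have := congrArg (fun φ : M →ₗ[ℂ] ℂ => φ (e.symm y)) h0
    simpa using this
  · intro h0
    rw [h0, LinearMap.zero_comp]

/-- (T2) in functional form: `perB σ = perA' (tw σ) ∘ ident σ` -/
theorem TransportInput.perB_eq (h : SeesawInput D) (R : TransportInput D h) (σ : h.Cons) :
    h.perB σ = (R.perA' (R.tw σ)).comp (R.ident σ : h.SpB σ →ₗ[ℂ] h.SpA (R.tw σ)) := by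
  ext x
  exact R.per_ident σ x

/-- **`PB_iff` PROVED**: the `(T', χ_B)`-period of `σ` is non-zero iff the `(T, χ_B')`-period of its transport is -/
theorem TransportInput.perB_ne_zero_iff (h : SeesawInput D) (R : TransportInput D h) (σ : h.Cons) :
    h.perB σ ≠ 0 ↔ R.perA' (R.tw σ) ≠ 0 := by
  rw [R.perB_eq D h σ]
  exact not_congr (comp_equiv_eq_zero_iff _ _)

/-- **the `TransportData` of §7 CONSTRUCTED** from the transport input, over the `TwoTorusData` constructed from the
seesaw input: `PB_iff` is the theorem `perB_ne_zero_iff`; `tw`, `tw_tw`, `swapOK`, `central` and the two necessity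
clauses are the displayed ones. -/
def transportData_of_input (h : SeesawInput D) (ho : OrthDistinct D) (R : TransportInput D h) :
    TransportData D (twoTorusData_of_seesaw D h ho) where
  tw := R.tw
  PA' := fun σ => R.perA' σ ≠ 0
  PB_iff := fun σ => R.perB_ne_zero_iff D h σ
  tw_tw := R.tw_tw
  swapOK := R.swapOK
  swapOK_of_periods := R.swapOK_of_periods
  central := R.central
  central_of_periods := R.central_of_periods

/-- the local-global form of the residual on the displayed spectrum: one constituent `σ` of `H^{2,0}(X_∞)`, sign-compatible
and central, with `P_T(σ, χ_A) ≠ 0` and `P_T(σ ∘ Ad(g⁻¹), χ_B') ≠ 0` -/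
theorem two_torus_local_of_input_iff (h : SeesawInput D) (ho : OrthDistinct D) (R : TransportInput D h) :
    TwoTorusLocal D (twoTorusData_of_seesaw D h ho) (transportData_of_input D h ho R) ↔
      ∃ σ : h.Cons, R.swapOK σ ∧ R.central σ ∧ h.perA σ ≠ 0 ∧ R.perA' (R.tw σ) ≠ 0 :=
  Iff.rfl

/-- and it is the two-torus statement on the displayed spectrum (`two_torus_iff_local` applied to the constructed data) -/
theorem two_torus_of_input_iff (h : SeesawInput D) (ho : OrthDistinct D) (R : TransportInput D h) :
    (∃ σ : h.Cons, h.perA σ ≠ 0 ∧ h.perB σ ≠ 0) ↔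
      ∃ σ : h.Cons, R.swapOK σ ∧ R.central σ ∧ h.perA σ ≠ 0 ∧ R.perA' (R.tw σ) ≠ 0 :=
  two_torus_iff_local D (twoTorusData_of_seesaw D h ho) (transportData_of_input D h ho R)

end

end Summit.Ventures.HodgeRepro2.Tier7.Line1
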